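import Mathlib
import Literature.MathematicalPhysics.QuantumFieldTheory.Balaban1983to89.B8Eq194CriterionTwoBlockDefect
import Literature.MathematicalPhysics.QuantumFieldTheory.Balaban1983to89.B8Eq194CriterionFibre

/-!
# G-B8-19 (c), last item: the (L, K) = (2, 2) torus is BACKGROUND-DEPENDENT — a two-block defect theorem on the
# (3.25)-lattice carriers and its (ℤ/4)^d instance in every dimension d ≥ 1

statement-level skeleton of published theorems with citation tags; proofs where landed; nothing here is a claim
about the Yang–Mills mass gap

Seat p40 gen 10, Phase 2 (free target; owner r05 row B8.Eq1.91; GAPS G-B8-19 (c) ADDENDUM 6 — precision: «for the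
(2,2)-TORUS only the flat half is kernel-checked (part 2/6: criterion holds) — its failure at a curved background is a
BY-HAND computation … NOT in the tree»).  Sources: [Balaban1985RegularSpaces] T. Bałaban, *Spaces of regular gauge
field configurations on a lattice and gauge fixing conditions*, CMP 99 (1985) 75–102: (1.91) p. 91 [PDF 17] «H′ =
G′²Q′\*(Q′G′²Q′\*)⁻¹»; [Balaban1985BackgroundPropagators] T. Bałaban, *Propagators for lattice gauge theories in a
background field*, CMP 99 (1985) 389–434: (3.3) p. 391 «(D^η_{U₀}A)(b) = η⁻¹(R(U₀(b))A(b₊) − A(b₋))», (3.19) p. 393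
«(Q′_j(U)λ)(y) = Σ_{x∈B^j(y)} L^{−jd} R(U(Γ^{(j)}_{y,x}))λ(x)», (3.23) p. 394 «Δ^η_U = D^{η\*}_U D^η_U», (3.24)–(3.25)
p. 394, (3.162)–(3.165) p. 429; [Balaban1985Averaging] (2) p. 17 (the cubes B(y)).

WHY THIS FILE.  Parts 1–7 of this seat and `B8Eq194CriterionCurved` (p308029/p308212) classified «(1.91)'s H′ = [4]'s
H′ (3.163)» ⟺ «Q′ΔN(Q′) = 0» on the free box and on the torus (ℤ/(LK))^d: with K ≥ 2 cubes per axis it FAILS at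
EVERY background iff L ≥ 2 — except on the torus with (L, K) = (2, 2), where every site of a cube is bonded to the
neighbouring cube and the two-site test function of `not_criterion_of_adjacent_blocks` is not available.  There the
flat criterion HOLDS (`B8Eq194CriterionCarriers.crit_torus_carriers_iff`), and GAPS G-B8-19 (c) ADDENDUM 6 (precision)
recorded its FAILURE at a curved background only as a hand computation (d = 1, cycle 0–1–2–3–0, one holonomy h ≠ 1
on the bond ⟨3, 0⟩: ⟨(Q′Δλ)({0,1}), v⟩ = κ⟨h⁻¹λ₂ − λ₂, v⟩).  This file kernel-checks it in every dimension.

CONTENT (the abstract two-block defect theorem `not_criterion_twoBlock_defect` — blocks c ≠ c′, a defect bond ⟨p, q⟩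
from B(c′) to B(c) carrying R, a further bond ⟨x₁, x₂⟩ between them with transport 1, ⟨(Q′Δλ)(c), v⟩ =
κ·(c_{⟨p,q⟩}⟨u, Rv⟩ − c_{⟨x₁,x₂⟩}⟨u, v⟩) for λ = δ_{x₂}u − δ_p u ∈ N(Q′) — is the companion file
`B8Eq194CriterionTwoBlockDefect`, imported).
THE (2, 2)-TORUS (ℤ/4)^d, d ≥ 1 (sites `Fin d → Fin (nSide 2 1)`, bonds ⟨x, x + e_i⟩ `torusBonds`, the 2^d cubes of
   side 2 `boxBlk 2 2`, unit bond weights, uniform block weight κ ≠ 0, ANY fibre V ≠ 0): with the defect on the bond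
   ⟨(3,0,…,0), (0,…,0)⟩ and any contours avoiding it, **`not_criterion_torus22_defect`** (R ≠ 1 ⟹ the criterion FAILS),
   while **`criterion_torus22_flat`** (R = 1, i.e. the flat background, any contours ⟹ it HOLDS; parts 2/6/7 by name);
   H′ forms **`Hp_ne_H4_torus22_defect`** (any (3.25)-data with a = diag(a_c), a_c ≠ 0, R injective) and
   **`H4_eq_Hp_torus22_flat`**; hypothesis-free **`exists_data_Hp_ne_H4_torus22_defect`** on the printed cubes (corner
   centres `yBox`, axis-by-axis contours `ΓBox`, which are chains of box bonds and therefore avoid the wrap-around defect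
   bond); packaged **`torus22_background_dependent`**.

NET (with parts 2/6/7 and `B8Eq194CriterionCurved`): on the torus (ℤ/(LK))^d with K ≥ 2 cubes of side L per axis,
«(1.91)'s H′ = [4]'s H′ (3.163)» holds at every background iff L = 1, fails at every background iff L ≥ 2 and
(L, K) ≠ (2, 2), and for (L, K) = (2, 2) — as for K = 1 — it DEPENDS ON THE BACKGROUND (flat: equal; one defect bond:
different).  Every clause of GAPS G-B8-19 (c) is now kernel-checked; no hand parenthesis remains.

HONEST SCOPE.  (i) The defect background is ONE non-trivial bond variable (curvature on the plaquettes through it);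
no classification of all backgrounds on the (2,2)-torus is attempted.  (ii) Transports: R any linear map with R ≠ 1
for the failure (injective for the existence of the (3.25)-data); R(U(b)) ∈ O(𝔤) in print.  (iii) Bond weights: unit
weights in §2 (general weights in §1 under c_{⟨p,q⟩}R ≠ c_{⟨x₁,x₂⟩}·1).  (iv) [4]'s Dirichlet b.c. are not treated (as
in parts 6–7).  No bound, no row head changes; value = the last open parenthesis of the cell's located reading
G-B8-19 (c) closed by the kernel, NOT summit progress.
-/

namespace Literature.MathematicalPhysics.QuantumFieldTheory.Balaban1983to89.B8Eq194CriterionTorus22Defect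

open Finset
open Literature.MathematicalPhysics.QuantumFieldTheory.Balaban1983to89.B9Eq323Ker
  Literature.MathematicalPhysics.QuantumFieldTheory.Balaban1983to89.B9Thm311Lattice
  Literature.MathematicalPhysics.QuantumFieldTheory.Balaban1983to89.B9Eq325Proj
  Literature.MathematicalPhysics.QuantumFieldTheory.Balaban1983to89.B8Eq191Hprime
  Literature.MathematicalPhysics.QuantumFieldTheory.Balaban1983to89.B8Eq194FirstTerm
  Literature.MathematicalPhysics.QuantumFieldTheory.Balaban1983to89.B8Eq194Criterion
  Literature.MathematicalPhysics.QuantumFieldTheory.Balaban1983to89.B8Eq194CriterionLattice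
  Literature.MathematicalPhysics.QuantumFieldTheory.Balaban1983to89.B8Eq194CriterionCarriers
  Literature.MathematicalPhysics.QuantumFieldTheory.Balaban1983to89.B8Eq194CriterionCarriersWitness
  Literature.MathematicalPhysics.QuantumFieldTheory.Balaban1983to89.B8Eq194CriterionCurved
  Literature.MathematicalPhysics.QuantumFieldTheory.Balaban1983to89.B8Eq194CriterionFibre
  Literature.MathematicalPhysics.QuantumFieldTheory.Balaban1983to89.B8Eq194CriterionTwoBlockDefect
open scoped InnerProductSpace

/-! ## §2  The (2, 2)-torus (ℤ/4)^d in every dimension: flat ⟹ the criterion holds, one defect bond ⟹ it fails -/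

section Torus22

variable (d : ℕ) {V : Type*} [NormedAddCommGroup V] [InnerProductSpace ℝ V] [FiniteDimensional ℝ V]

/-- coordinates of `axisSite` (part D's lemma is private). [folklore] -/
private theorem axisSite_val' (i₀ : Fin d) (n : ℕ) (hn : n < nSide 2 1) (i : Fin d) :
    (axisSite d 2 1 i₀ n hn i).val = if i = i₀ then n else 0 := by
  unfold axisSite
  split_ifs <;> rfl

/-- coordinates of `axisBlk` (part D's lemma is private). [folklore] -/
private theorem axisBlk_val' (i₀ : Fin d) (m : ℕ) (hm : m < 2) (i : Fin d) :
    (axisBlk d 2 i₀ m hm i).val = if i = i₀ then m else 0 := by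
  unfold axisBlk
  split_ifs <;> rfl

/-- **The (2, 2)-torus at the FLAT background: the criterion HOLDS** — (ℤ/4)^d with all bonds ⟨x, x + e_i⟩ and unit
bond weights, the 2^d cubes of side 2 with uniform weight κ ≠ 0, any fibre V ≠ 0, ANY contours and centres, all
transports 1 (written as `defectT p q 1` for the comparison with the defect background): Q′ΔN(Q′) = 0.  Parts 2/6
(`crit_torus_carriers_iff`, the scalar weights) and part 7 (`criterion_fibre_iff`, the fibre) by name.
[cite: Balaban1985RegularSpaces, (1.91) p. 91, p. 77 (T_η); Balaban1985BackgroundPropagators, (3.19) p. 393,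
(3.23) p. 394, (3.162)–(3.165) p. 429; Balaban1985Averaging, (2) p. 17] -/
theorem criterion_torus22_flat (hd : 0 < d) [Nontrivial V] (p q : Fin d → Fin (nSide 2 1)) {κ : ℝ} (hκ : κ ≠ 0)
    (Γ : (Fin d → Fin 2) → (Fin d → Fin (nSide 2 1)) → List (Fin d → Fin (nSide 2 1)))
    (y : (Fin d → Fin 2) → Fin d → Fin (nSide 2 1)) :
    ∀ f : PiLp 2 (fun _ : Fin d → Fin (nSide 2 1) => V),
      qL (defectT p q LinearMap.id) (fun _ _ => κ) (blocksOf (boxBlk (1 + 1) 2 rfl)) Γ y f = 0 →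
        qL (defectT p q LinearMap.id) (fun _ _ => κ) (blocksOf (boxBlk (1 + 1) 2 rfl)) Γ y
          (lapL (defectT p q LinearMap.id) (torusBonds (Fin d) (nSide 2 1)) (fun _ => 1) f) = 0 := by
  haveI : Nonempty (Fin d) := ⟨⟨0, hd⟩⟩
  have hflat : defectT p q (LinearMap.id : V →ₗ[ℝ] V) = flatTV V (Fin d → Fin (nSide 2 1)) := by
    funext x x'
    unfold defectT
    split_ifs <;> rfl
  rw [hflat]
  exact (criterion_fibre_iff _ _ Γ y _ _).2 ((criterion_flat_iff (boxBlk (1 + 1) 2 rfl) hκ Γ y _ _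
    (fun _ _ => zero_le_one)).2 ((crit_torus_carriers_iff rfl (by norm_num) (by norm_num)).2
      (Or.inr (Or.inr ⟨rfl, rfl⟩))))

/-- **The (2, 2)-torus with ONE DEFECT BOND: the criterion FAILS** — same carriers ((ℤ/4)^d, unit bond weights, cubes
of side 2 with uniform weight κ ≠ 0, any fibre V), transports 1 except R ≠ 1 on the wrap-around bond ⟨p, q⟩ =
⟨(3,0,…,0), (0,…,0)⟩ (coordinate 3 on the axis i₀), ANY contours and centres avoiding that bond: some λ ∈ N(Q′) has
Q′Δλ ≠ 0 (§1 with x₁ = e_{i₀}, x₂ = 2e_{i₀}, the cubes c ∋ 0 and c′ ∋ 2e_{i₀}: ⟨(Q′Δλ)(c), v⟩ = κ⟨u, Rv − v⟩).  This is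
the hand computation of GAPS G-B8-19 (c) ADDENDUM 6 (d = 1: ⟨(Q′Δλ)({0,1}), v⟩ = κ⟨h⁻¹λ₂ − λ₂, v⟩), kernel-checked in
every d ≥ 1. [cite: Balaban1985RegularSpaces, (1.91) p. 91, p. 77 (T_η); Balaban1985BackgroundPropagators, (3.3)
p. 391, (3.19) p. 393, (3.23) p. 394, (3.162)–(3.165) p. 429; Balaban1985Averaging, (2) p. 17] -/
theorem not_criterion_torus22_defect [Nontrivial V] (i₀ : Fin d) {p q : Fin d → Fin (nSide 2 1)}
    (hp : ∀ i, (p i).val = if i = i₀ then 3 else 0) (hq : ∀ i, (q i).val = 0) {κ : ℝ} (hκ : κ ≠ 0)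
    (Γ : (Fin d → Fin 2) → (Fin d → Fin (nSide 2 1)) → List (Fin d → Fin (nSide 2 1)))
    (y : (Fin d → Fin 2) → Fin d → Fin (nSide 2 1))
    (havoid : ∀ c, ∀ x ∈ blocksOf (boxBlk (1 + 1) 2 rfl) c, List.IsChain (fun a b => ¬ (a = p ∧ b = q)) (y c :: Γ c x))
    {R : V →ₗ[ℝ] V} (hR1 : R ≠ LinearMap.id) :
    ¬ ∀ f : PiLp 2 (fun _ : Fin d → Fin (nSide 2 1) => V),
      qL (defectT p q R) (fun _ _ => κ) (blocksOf (boxBlk (1 + 1) 2 rfl)) Γ y f = 0 →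
        qL (defectT p q R) (fun _ _ => κ) (blocksOf (boxBlk (1 + 1) 2 rfl)) Γ y
          (lapL (defectT p q R) (torusBonds (Fin d) (nSide 2 1)) (fun _ => 1) f) = 0 := by
  have hN : ∀ n : ℕ, n % nSide 2 1 = n % 4 := fun n => rfl
  have hlt : ∀ (x : Fin d → Fin (nSide 2 1)) (i : Fin d), (x i).val < 4 := fun x i => (x i).isLt
  set x₁ := axisSite d 2 1 i₀ 1 (by decide) with hx₁
  set x₂ := axisSite d 2 1 i₀ 2 (by decide) with hx₂
  set c := axisBlk d 2 i₀ 0 (by decide) with hc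
  set c' := axisBlk d 2 i₀ 1 (by decide) with hc'
  have hp0 : (p i₀).val = 3 := by rw [hp, if_pos rfl]
  have hx₁0 : (x₁ i₀).val = 1 := by rw [hx₁, axisSite_val', if_pos rfl]
  have hx₂0 : (x₂ i₀).val = 2 := by rw [hx₂, axisSite_val', if_pos rfl]
  -- membership in the cube c forces the i₀-coordinate below 2
  have memc : ∀ x, x ∈ blocksOf (boxBlk (1 + 1) 2 rfl) c → (x i₀).val < 2 := by
    intro x hx
    have h1 := (mem_blocksOf_boxBlk_iff d 2 1 x c).1 hx i₀
    rw [hc, axisBlk_val', if_pos rfl] at h1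
    omega
  have hcc : c ≠ c' := by
    intro h
    have h1 := congrArg (fun e : Fin d → Fin 2 => (e i₀).val) h
    rw [hc, hc', axisBlk_val', axisBlk_val', if_pos rfl, if_pos rfl] at h1
    exact zero_ne_one h1
  have hpm : p ∈ blocksOf (boxBlk (1 + 1) 2 rfl) c' := by
    rw [mem_blocksOf_boxBlk_iff]
    intro i
    rw [hp, hc', axisBlk_val']
    split_ifs <;> rfl
  have hqm : q ∈ blocksOf (boxBlk (1 + 1) 2 rfl) c := by
    rw [mem_blocksOf_boxBlk_iff]
    intro i
    rw [hq, hc, axisBlk_val']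
    split_ifs <;> rfl
  have hx₂m : x₂ ∈ blocksOf (boxBlk (1 + 1) 2 rfl) c' := (axisSite_mem_iff d 2 1 i₀ 2 _ 1 _).2 rfl
  have hx₁m : x₁ ∈ blocksOf (boxBlk (1 + 1) 2 rfl) c := (axisSite_mem_iff d 2 1 i₀ 1 _ 0 _).2 rfl
  have hpx : p ≠ x₂ := by
    intro h
    have h1 := congrArg (fun e : Fin d → Fin (nSide 2 1) => (e i₀).val) h
    rw [hp0, hx₂0] at h1
    omega
  have honly : ∀ (z : Fin d → Fin (nSide 2 1)) (c₁ c₂ : Fin d → Fin 2), z ∈ blocksOf (boxBlk (1 + 1) 2 rfl) c₁ →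
      z ∈ blocksOf (boxBlk (1 + 1) 2 rfl) c₂ → c₁ = c₂ := by
    intro z c₁ c₂ h₁ h₂
    funext i
    exact Fin.ext (((mem_blocksOf_boxBlk_iff d 2 1 z c₁).1 h₁ i).symm.trans ((mem_blocksOf_boxBlk_iff d 2 1 z c₂).1 h₂ i))
  -- the two bonds ⟨p, q⟩ and ⟨x₁, x₂⟩ of the torus
  have hpq : (p, q) ∈ torusBonds (Fin d) (nSide 2 1) := by
    refine (mem_torusBonds p q).2 ⟨i₀, ?_, fun j hj => Fin.ext ?_⟩
    · rw [hq, hp0]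
      rfl
    · rw [hq, hp, if_neg hj]
  have h12 : (x₁, x₂) ∈ torusBonds (Fin d) (nSide 2 1) := by
    refine (mem_torusBonds x₁ x₂).2 ⟨i₀, ?_, fun j hj => Fin.ext ?_⟩
    · rw [hx₂0, hx₁0]
      rfl
    · rw [hx₁, hx₂, axisSite_val', axisSite_val', if_neg hj, if_neg hj]
  -- every other torus bond touching p or x₂ has both ends with i₀-coordinate ≥ 2, hence off the cube c
  have hfar : ∀ b ∈ torusBonds (Fin d) (nSide 2 1), b ≠ (p, q) → b ≠ (x₁, x₂) →
      (b.1 = p ∨ b.1 = x₂ ∨ b.2 = p ∨ b.2 = x₂) →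
      b.1 ∉ blocksOf (boxBlk (1 + 1) 2 rfl) c ∧ b.2 ∉ blocksOf (boxBlk (1 + 1) 2 rfl) c := by
    rintro ⟨z, z'⟩ hb hbpq hb12 htouch
    obtain ⟨i, hi, hrest⟩ := (mem_torusBonds z z').1 hb
    rw [hN] at hi
    dsimp only at hbpq hb12 htouch ⊢
    -- it suffices to bound both i₀-coordinates from below by 2
    suffices h2 : 2 ≤ (z i₀).val ∧ 2 ≤ (z' i₀).val from
      ⟨fun h => absurd (memc z h) (not_lt.2 h2.1), fun h => absurd (memc z' h) (not_lt.2 h2.2)⟩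
    have hzlt := hlt z i
    have hsame : i ≠ i₀ → (z' i₀).val = (z i₀).val := fun hii => congrArg Fin.val (hrest i₀ (Ne.symm hii))
    rcases htouch with h | h | h | h
    · -- z = p
      have hz : (z i₀).val = 3 := by rw [h]; exact hp0
      by_cases hii : i = i₀
      · rw [hii] at hi hrest
        exfalso
        refine hbpq (Prod.ext h (funext fun j => Fin.ext ?_))
        show (z' j).val = (q j).val
        by_cases hj : j = i₀
        · rw [hj]
          have e3 := hq i₀
          omega
        · have e1 := congrArg Fin.val (hrest j hj)
          have e2 : (z j).val = 0 := by rw [h, hp, if_neg hj]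
          have e3 := hq j
          omega
      · have e1 := hsame hii
        omega
    · -- z = x₂
      have hz : (z i₀).val = 2 := by rw [h]; exact hx₂0
      by_cases hii : i = i₀
      · rw [hii] at hi
        omega
      · have e1 := hsame hii
        omega
    · -- z' = p
      have hz' : (z' i₀).val = 3 := by rw [h]; exact hp0
      by_cases hii : i = i₀
      · rw [hii] at hi hzlt
        omega
      · have e1 := hsame hii
        omega
    · -- z' = x₂
      have hz' : (z' i₀).val = 2 := by rw [h]; exact hx₂0
      by_cases hii : i = i₀
      · rw [hii] at hi hrest hzlt
        exfalso
        refine hb12 (Prod.ext (funext fun j => Fin.ext ?_) h)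
        show (z j).val = (x₁ j).val
        by_cases hj : j = i₀
        · rw [hj, hx₁0]
          omega
        · have e1 := congrArg Fin.val (hrest j hj)
          have e2 : (z' j).val = 0 := by rw [h, hx₂, axisSite_val', if_neg hj]
          have e3 : (x₁ j).val = 0 := by rw [hx₁, axisSite_val', if_neg hj]
          omega
      · have e1 := hsame hii
        omega
  have hR : (fun _ : (Fin d → Fin (nSide 2 1)) × (Fin d → Fin (nSide 2 1)) => (1 : ℝ)) (p, q) • R
      ≠ (fun _ : (Fin d → Fin (nSide 2 1)) × (Fin d → Fin (nSide 2 1)) => (1 : ℝ)) (x₁, x₂) • LinearMap.id := by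
    rwa [one_smul, one_smul]
  exact not_criterion_twoBlock_defect (fun _ => (1 : ℝ)) (fun _ _ => zero_le_one) Γ y hcc hκ hpm hx₂m hqm hx₁m hpx
    (fun c'' h => honly p c'' c' h hpm) (fun c'' h => honly x₂ c'' c' h hx₂m) (fun _ _ => rfl) rfl hpq h12 hfar
    (havoid c) (havoid c' p hpm) (havoid c' x₂ hx₂m) hR

/-- **H′ form, flat (2, 2)-torus: (1.91)'s H′ = [4]'s H′ (3.163)** for every (3.25)-data (any contours and
centres, a = diag(a_c) arbitrary). [cite: Balaban1985RegularSpaces, (1.91) p. 91, p. 77 (T_η);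
Balaban1985BackgroundPropagators, (3.24)–(3.25) p. 394, (3.163)–(3.165) p. 429] -/
theorem H4_eq_Hp_torus22_flat (hd : 0 < d) [Nontrivial V] (p q : Fin d → Fin (nSide 2 1)) {κ : ℝ} (hκ : κ ≠ 0)
    (Γ : (Fin d → Fin 2) → (Fin d → Fin (nSide 2 1)) → List (Fin d → Fin (nSide 2 1)))
    (y : (Fin d → Fin 2) → Fin d → Fin (nSide 2 1)) (a : (Fin d → Fin 2) → ℝ)
    {g : PiLp 2 (fun _ : Fin d → Fin (nSide 2 1) => V) →ₗ[ℝ] PiLp 2 (fun _ : Fin d → Fin (nSide 2 1) => V)}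
    {cc : PiLp 2 (fun _ : Fin d → Fin 2 => V) →ₗ[ℝ] PiLp 2 (fun _ : Fin d → Fin 2 => V)}
    (hdata : Data (lapL (defectT p q LinearMap.id) (torusBonds (Fin d) (nSide 2 1)) (fun _ => 1))
      (qL (defectT p q LinearMap.id) (fun _ _ => κ) (blocksOf (boxBlk (1 + 1) 2 rfl)) Γ y)
      (LinearMap.adjoint (qL (defectT p q LinearMap.id) (fun _ _ => κ) (blocksOf (boxBlk (1 + 1) 2 rfl)) Γ y))
      (AL a) g cc) (μ : PiLp 2 (fun _ : Fin d → Fin 2 => V)) :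
    H4 (qL (defectT p q LinearMap.id) (fun _ _ => κ) (blocksOf (boxBlk (1 + 1) 2 rfl)) Γ y)
        (LinearMap.adjoint (qL (defectT p q LinearMap.id) (fun _ _ => κ) (blocksOf (boxBlk (1 + 1) 2 rfl)) Γ y))
        (AL a) g cc μ
      = Hp (LinearMap.adjoint (qL (defectT p q LinearMap.id) (fun _ _ => κ) (blocksOf (boxBlk (1 + 1) 2 rfl)) Γ y))
        g cc μ :=
  H4_eq_Hp_of_criterion hdata (criterion_torus22_flat d hd p q hκ Γ y) μ

/-- **H′ form, (2, 2)-torus with one defect bond: (1.91)'s H′ ≠ [4]'s H′ (3.163)** for every (3.25)-data with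
a = diag(a_c), a_c ≠ 0 (any contours/centres avoiding the defect bond, any fibre V ≠ 0, R ≠ 1).
[cite: Balaban1985RegularSpaces, (1.91) p. 91, p. 77 (T_η); Balaban1985BackgroundPropagators, (3.24)–(3.25) p. 394,
(3.163)–(3.165) p. 429] -/
theorem Hp_ne_H4_torus22_defect [Nontrivial V] (i₀ : Fin d) {p q : Fin d → Fin (nSide 2 1)}
    (hp : ∀ i, (p i).val = if i = i₀ then 3 else 0) (hq : ∀ i, (q i).val = 0) {κ : ℝ} (hκ : κ ≠ 0)
    (Γ : (Fin d → Fin 2) → (Fin d → Fin (nSide 2 1)) → List (Fin d → Fin (nSide 2 1)))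
    (y : (Fin d → Fin 2) → Fin d → Fin (nSide 2 1))
    (havoid : ∀ c, ∀ x ∈ blocksOf (boxBlk (1 + 1) 2 rfl) c, List.IsChain (fun a b => ¬ (a = p ∧ b = q)) (y c :: Γ c x))
    {R : V →ₗ[ℝ] V} (hR1 : R ≠ LinearMap.id) (a : (Fin d → Fin 2) → ℝ) (ha : ∀ c, a c ≠ 0)
    {g : PiLp 2 (fun _ : Fin d → Fin (nSide 2 1) => V) →ₗ[ℝ] PiLp 2 (fun _ : Fin d → Fin (nSide 2 1) => V)}
    {cc : PiLp 2 (fun _ : Fin d → Fin 2 => V) →ₗ[ℝ] PiLp 2 (fun _ : Fin d → Fin 2 => V)}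
    (hdata : Data (lapL (defectT p q R) (torusBonds (Fin d) (nSide 2 1)) (fun _ => 1))
      (qL (defectT p q R) (fun _ _ => κ) (blocksOf (boxBlk (1 + 1) 2 rfl)) Γ y)
      (LinearMap.adjoint (qL (defectT p q R) (fun _ _ => κ) (blocksOf (boxBlk (1 + 1) 2 rfl)) Γ y)) (AL a) g cc) :
    ∃ μ, Hp (LinearMap.adjoint (qL (defectT p q R) (fun _ _ => κ) (blocksOf (boxBlk (1 + 1) 2 rfl)) Γ y)) g cc μ
      ≠ H4 (qL (defectT p q R) (fun _ _ => κ) (blocksOf (boxBlk (1 + 1) 2 rfl)) Γ y)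
          (LinearMap.adjoint (qL (defectT p q R) (fun _ _ => κ) (blocksOf (boxBlk (1 + 1) 2 rfl)) Γ y))
          (AL a) g cc μ := by
  by_contra hall
  refine not_criterion_torus22_defect d i₀ hp hq hκ Γ y havoid hR1
    (criterion_of_H4_eq_Hp hdata (AL_surjectiveV a ha) fun μ => ?_)
  by_contra hμ
  exact hall ⟨μ, fun e => hμ e.symm⟩

/-- **Hypothesis-free, (2, 2)-torus with one defect bond, the PRINTED cubes** (corner centres `yBox`, axis-by-axis
contours `ΓBox` — chains of box bonds ⟨x, x + e_i⟩ without wrap-around, hence avoiding the defect bond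
⟨(3,0,…,0), (0,…,0)⟩): for R injective, R ≠ 1, uniform κ ≠ 0, unit bond weights, a_c > 0, the (3.25)-data EXIST at
this background ([4] Thm 3.11 «obvious» on the lattice, `B8Eq191Hprime.data_L`) and (1.91)'s H′ ≠ [4]'s H′ (3.163).
[cite: Balaban1985RegularSpaces, (1.91) p. 91, p. 77 (T_η); Balaban1985BackgroundPropagators, (3.18)–(3.19) p. 393,
(3.24)–(3.25) p. 394, Thm 3.11 p. 416, (3.163)–(3.165) p. 429; Balaban1985Averaging, (2) p. 17] -/
theorem exists_data_Hp_ne_H4_torus22_defect [Nontrivial V] (i₀ : Fin d) {p q : Fin d → Fin (nSide 2 1)}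
    (hp : ∀ i, (p i).val = if i = i₀ then 3 else 0) (hq : ∀ i, (q i).val = 0) {κ : ℝ} (hκ : κ ≠ 0)
    {R : V →ₗ[ℝ] V} (hR : Function.Injective R) (hR1 : R ≠ LinearMap.id) (a : (Fin d → Fin 2) → ℝ)
    (ha : ∀ c, 0 < a c) :
    ∃ (g : PiLp 2 (fun _ : Fin d → Fin (nSide 2 1) => V) →ₗ[ℝ] PiLp 2 (fun _ : Fin d → Fin (nSide 2 1) => V))
      (cc : PiLp 2 (fun _ : Fin d → Fin 2 => V) →ₗ[ℝ] PiLp 2 (fun _ : Fin d → Fin 2 => V)),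
      Data (lapL (defectT p q R) (torusBonds (Fin d) (nSide 2 1)) (fun _ => 1))
          (qL (defectT p q R) (fun _ _ => κ) (blocksOf (boxBlk (1 + 1) 2 rfl)) (ΓBox d 2 1) (yBox d 2 1))
          (LinearMap.adjoint
            (qL (defectT p q R) (fun _ _ => κ) (blocksOf (boxBlk (1 + 1) 2 rfl)) (ΓBox d 2 1) (yBox d 2 1)))
          (AL a) g cc ∧
        ∃ μ, Hp (LinearMap.adjoint
              (qL (defectT p q R) (fun _ _ => κ) (blocksOf (boxBlk (1 + 1) 2 rfl)) (ΓBox d 2 1) (yBox d 2 1))) g cc μ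
          ≠ H4 (qL (defectT p q R) (fun _ _ => κ) (blocksOf (boxBlk (1 + 1) 2 rfl)) (ΓBox d 2 1) (yBox d 2 1))
              (LinearMap.adjoint
                (qL (defectT p q R) (fun _ _ => κ) (blocksOf (boxBlk (1 + 1) 2 rfl)) (ΓBox d 2 1) (yBox d 2 1)))
              (AL a) g cc μ := by
  have hcb : ∀ b ∈ torusBonds (Fin d) (nSide 2 1), (0 : ℝ) < (fun _ => (1 : ℝ)) b := fun _ _ => one_pos
  have hS := isBlockSystem_torus d 2 1 hκ
  have hinj := defectT_injective p q hR
  -- the printed contours are chains of BOX bonds; the defect bond wraps around the torus and is not one of them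
  have hnot : (p, q) ∉ boxBonds (Fin d) (nSide 2 1) := by
    intro hb
    obtain ⟨i, hi, -⟩ := (mem_boxBonds p q).1 hb
    rw [hq, hp] at hi
    by_cases hii : i = i₀
    · rw [if_pos hii] at hi
      omega
    · rw [if_neg hii] at hi
      omega
  have havoid : ∀ c, ∀ x ∈ blocksOf (boxBlk (1 + 1) 2 rfl) c,
      List.IsChain (fun a b => ¬ (a = p ∧ b = q)) (yBox d 2 1 c :: ΓBox d 2 1 c x) := by
    intro c x hx
    refine ((isBlockSystem_box d 2 1 hκ).chain c x hx).imp fun a b hab => ?_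
    rintro ⟨rfl, rfl⟩
    exact hnot hab
  exact ⟨gL (defectT p q R) (fun _ => 1) a hinj hcb hS ha, cL (defectT p q R) (fun _ => 1) a hinj hcb hS ha,
    data_L hinj hcb hS ha,
    Hp_ne_H4_torus22_defect d i₀ hp hq hκ _ _ havoid hR1 a (fun c => (ha c).ne') (data_L hinj hcb hS ha)⟩

/-- **The (2, 2)-torus is BACKGROUND-DEPENDENT** (every d ≥ 1, every fibre V ≠ 0, uniform κ ≠ 0, unit bond weights, the
cubes of side 2, any contour system avoiding the bond ⟨p, q⟩ = ⟨(3,0,…,0), (0,…,0)⟩ — e.g. the printed one): at the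
flat background the criterion Q′ΔN(Q′) = 0 HOLDS, at the background with the single defect R ≠ 1 on ⟨p, q⟩ it FAILS.
With `B8Eq194CriterionCurved` (K = 1; (L, K) ≠ (2, 2)) this closes the classification of GAPS G-B8-19 (c) on the
torus: background-independent failure iff L ≥ 2 ∧ (L, K) ≠ (2, 2), background-independent validity iff L = 1.
[cite: Balaban1985RegularSpaces, (1.91) p. 91, p. 77 (T_η); Balaban1985BackgroundPropagators, (3.19) p. 393,
(3.23) p. 394, (3.162)–(3.165) p. 429; Balaban1985Averaging, (2) p. 17] -/
theorem torus22_background_dependent [Nontrivial V] (i₀ : Fin d) {p q : Fin d → Fin (nSide 2 1)}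
    (hp : ∀ i, (p i).val = if i = i₀ then 3 else 0) (hq : ∀ i, (q i).val = 0) {κ : ℝ} (hκ : κ ≠ 0)
    (Γ : (Fin d → Fin 2) → (Fin d → Fin (nSide 2 1)) → List (Fin d → Fin (nSide 2 1)))
    (y : (Fin d → Fin 2) → Fin d → Fin (nSide 2 1))
    (havoid : ∀ c, ∀ x ∈ blocksOf (boxBlk (1 + 1) 2 rfl) c, List.IsChain (fun a b => ¬ (a = p ∧ b = q)) (y c :: Γ c x))
    {R : V →ₗ[ℝ] V} (hR1 : R ≠ LinearMap.id) :
    (∀ f : PiLp 2 (fun _ : Fin d → Fin (nSide 2 1) => V),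
        qL (defectT p q LinearMap.id) (fun _ _ => κ) (blocksOf (boxBlk (1 + 1) 2 rfl)) Γ y f = 0 →
          qL (defectT p q LinearMap.id) (fun _ _ => κ) (blocksOf (boxBlk (1 + 1) 2 rfl)) Γ y
            (lapL (defectT p q LinearMap.id) (torusBonds (Fin d) (nSide 2 1)) (fun _ => 1) f) = 0) ∧
      ¬ ∀ f : PiLp 2 (fun _ : Fin d → Fin (nSide 2 1) => V),
        qL (defectT p q R) (fun _ _ => κ) (blocksOf (boxBlk (1 + 1) 2 rfl)) Γ y f = 0 →
          qL (defectT p q R) (fun _ _ => κ) (blocksOf (boxBlk (1 + 1) 2 rfl)) Γ y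
            (lapL (defectT p q R) (torusBonds (Fin d) (nSide 2 1)) (fun _ => 1) f) = 0 :=
  ⟨criterion_torus22_flat d (Fin.pos i₀) p q hκ Γ y, not_criterion_torus22_defect d i₀ hp hq hκ Γ y havoid hR1⟩

omit [FiniteDimensional ℝ V] in
/-- Non-vacuity of the hypotheses: the sites p = (3,0,…,0), q = (0,…,0) exist (d ≥ 1) and R = −1 is an injective
transport ≠ 1 on any fibre V ≠ 0. [cite: Balaban1985BackgroundPropagators, (3.3) p. 391, (3.18) p. 393] -/
theorem exists_defect_data [Nontrivial V] (hd : 0 < d) :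
    ∃ (i₀ : Fin d) (p q : Fin d → Fin (nSide 2 1)) (R : V →ₗ[ℝ] V),
      (∀ i, (p i).val = if i = i₀ then 3 else 0) ∧ (∀ i, (q i).val = 0) ∧ Function.Injective R ∧
        R ≠ LinearMap.id := by
  refine ⟨⟨0, hd⟩, axisSite d 2 1 ⟨0, hd⟩ 3 (by decide), axisSite d 2 1 ⟨0, hd⟩ 0 (by decide), -LinearMap.id,
    fun i => axisSite_val' d _ 3 _ i, fun i => ?_, ?_, ?_⟩
  · rw [axisSite_val']
    split_ifs <;> rfl
  · exact fun a b h => neg_injective h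
  · intro h
    obtain ⟨v, hv⟩ := exists_ne (0 : V)
    have h1 := congrArg (fun T : V →ₗ[ℝ] V => T v) h
    simp only [LinearMap.neg_apply, LinearMap.id_apply] at h1
    have h2 : (2 : ℝ) • v = 0 := by
      rw [two_smul]
      nth_rw 1 [← h1]
      exact neg_add_cancel v
    exact hv ((smul_eq_zero.mp h2).resolve_left two_ne_zero)

end Torus22

end Literature.MathematicalPhysics.QuantumFieldTheory.Balaban1983to89.B8Eq194CriterionTorus22Defect
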